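import Literature.Analysis.FluidPDE.KNSSRegularityWindow
import Literature.Analysis.FluidPDE.KNSSRegularityGluing
import HarnessLib

/-!
# KNSS 2009, §4 on `ℝ³ × (−∞, 0)`: the ancient regularity fact from the finite-window fact

Analysis/FluidPDE proofs file (the sibling `KNSSRegularityProofs` discharges the other fact of
`KNSSRegularity`, Lemma 2.1 in half-ball form). Main result:

* `Literature.Analysis.FluidPDE.KNSS2009_regularity_boundedWeak_ancient_of_window` :
  `KNSS2009_regularity_boundedWeak_window → KNSS2009_regularity_boundedWeak_ancient`.

That is, the regularity of bounded weak solutions of Navier–Stokes on `ℝ³ × (−∞, 0)` with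
constants uniform in time (`KNSSRegularity`; the input of the proofs of Theorems 5.2–5.3 of
Koch–Nadirashvili–Seregin–Šverák, Acta Math. 203 (2009) = arXiv:0709.3599: "By the results of
Section 4, we have `|∇ᵏₓu| ≤ C_k` in `ℝ³ × (−∞, 0)`") is reduced to Section 4 **as printed**, on
a finite window `ℝ³ × (0, T)` with constants `C(k, δ, T, M)` (`KNSSRegularityWindow`). With this,
discharging the printed statement (Lemma 3.1, the linear estimates (3.10)–(3.14),
Proposition 4.1 and the vorticity bootstrap (4.7)–(4.11) of the source) discharges the ancient
fact.

The proof: `KNSS2009_regularity_boundedWeak_window.shift` moves the window statement to any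
window `(a, a + T)` (time translation of the class, `IsBoundedWeakNSSolutionOn.comp_add_right`,
and of the representative); it is applied with `T = 4`, `δ = 1` to the restrictions of `u` to
`W_j = (−j − 4, −j)`, `j ∈ ℕ` (`IsBoundedWeakNSSolutionOn.mono`), the constants depending only on
`M = sup ‖u‖`; the decompositions are glued along `ι(t) = ⌈−t⌉₊ − 1` (`t ∈ [−ι(t) − 1, −ι(t))`)
with the lemmas of `KNSSRegularityGluing`; and the time-integrated vorticity equation of the
glued field is obtained here (`glue_vorticity_local`, `glue_vorticity`): on a short interval
`[s, t]` inside the good range of the window `ι(t)` the window identity transfers (derivative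
terms are intrinsic, the order-`0` term `U + b` agrees for a.e. `τ`, so the integrands agree
a.e.; the window integrand is integrable, being a sum of terms continuous in `τ` and one bounded
measurable term), and long intervals are chained at the points `s + 1, s + 2, …`
(`intervalIntegral.integral_add_adjacent_intervals`).

## References

* G. Koch, N. Nadirashvili, G. Seregin, V. Šverák, *Liouville theorems for the Navier–Stokes
  equations and applications*, Acta Math. 203 (2009) 83–105 = arXiv:0709.3599v1: §3 Lemma 3.1,
  Remark 3.1; §4 (4.7)–(4.11); §5, proof of Theorem 5.2, first sentence.
  [KochNadirashviliSereginSverak2009]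
-/

noncomputable section

open MeasureTheory Set Function Filter TopologicalSpace InnerProductSpace
open scoped RealInnerProductSpace Laplacian ContDiff NNReal

namespace Literature.Analysis.FluidPDE

section GluingVorticity

variable {u : ℝ → EuclideanSpace ℝ (Fin 3) → EuclideanSpace ℝ (Fin 3)}
  {Uw : ℕ → ℝ → EuclideanSpace ℝ (Fin 3) → EuclideanSpace ℝ (Fin 3)}
  {bw : ℕ → ℝ → EuclideanSpace ℝ (Fin 3)} {ι : ℝ → ℕ}

/-! ### The vorticity identity of the glued field -/

/-- **Local vorticity identity for the glued field, with integrability.** If `s ≤ t < 0` and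
`s` lies in the good range of the window `ι(t)` selected at `t`, then the time-integrated
vorticity equation of that window transfers to the glued field: the vorticities and all
derivative-level terms of the integrand are intrinsic on the good range
(`overlap_curl_eq`, `overlap_fderiv_eq`), the order-`0` term `U + b` agrees for a.e. `τ`
(`ae_overlap_apply_eq`), so the integrands agree a.e. on `[s, t]`; the window integrand is
integrable there (continuous terms, `continuousOn_*_family`, plus a bounded measurable one). [folklore] -/
theorem glue_vorticity_local
    (hbm : ∀ j, Measurable (bw j)) {N : ℝ} (hbN : ∀ j t, ‖bw j t‖ ≤ N)
    (hae : ∀ j : ℕ, ∀ᵐ t ∂((volume : Measure ℝ).restrict (Ioo (-(j : ℝ) - 4) (-(j : ℝ)))),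
      u t =ᵐ[volume] fun x => Uw j t x + bw j t)
    (hsm : ∀ j : ℕ, ∀ t ∈ Ioo (-(j : ℝ) - 4) (-(j : ℝ)), ContDiff ℝ ∞ (Uw j t))
    {C L : ℕ → ℝ}
    (hbd : ∀ (j k : ℕ), ∀ t ∈ Ioo (-(j : ℝ) - 3) (-(j : ℝ)), ∀ x, ‖iteratedFDeriv ℝ k (Uw j t) x‖ ≤ C k)
    (hlip : ∀ (j k : ℕ), ∀ s ∈ Ioo (-(j : ℝ) - 3) (-(j : ℝ)), ∀ t ∈ Ioo (-(j : ℝ) - 3) (-(j : ℝ)), ∀ x,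
      ‖iteratedFDeriv ℝ k (Uw j t) x - iteratedFDeriv ℝ k (Uw j s) x‖ ≤ L k * |t - s|)
    (hvort : ∀ (j : ℕ) (x : EuclideanSpace ℝ (Fin 3)) (s t : ℝ),
      -(j : ℝ) - 3 < s → s ≤ t → t < -(j : ℝ) →
      curl (Uw j t) x - curl (Uw j s) x =
        ∫ τ in s..t, (Δ (curl (Uw j τ)) x - fderiv ℝ (curl (Uw j τ)) x (Uw j τ x + bw j τ) +
          fderiv ℝ (Uw j τ) x (curl (Uw j τ) x)))
    (hι : ∀ t < 0, -(ι t : ℝ) - 1 ≤ t ∧ t < -(ι t : ℝ))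
    (x : EuclideanSpace ℝ (Fin 3)) {s t : ℝ} (hst : s ≤ t) (ht : t < 0) (hs : -(ι t : ℝ) - 3 < s) :
    IntervalIntegrable (fun τ => Δ (curl (Uw (ι τ) τ)) x -
        fderiv ℝ (curl (Uw (ι τ) τ)) x (Uw (ι τ) τ x + bw (ι τ) τ) +
        fderiv ℝ (Uw (ι τ) τ) x (curl (Uw (ι τ) τ) x)) volume s t ∧
      curl (Uw (ι t) t) x - curl (Uw (ι s) s) x =
        ∫ τ in s..t, (Δ (curl (Uw (ι τ) τ)) x -
          fderiv ℝ (curl (Uw (ι τ) τ)) x (Uw (ι τ) τ x + bw (ι τ) τ) +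
          fderiv ℝ (Uw (ι τ) τ) x (curl (Uw (ι τ) τ) x)) := by
  have hWG : ∀ (i : ℕ) (τ : ℝ), τ ∈ Ioo (-(i : ℝ) - 3) (-(i : ℝ)) →
      τ ∈ Ioo (-(i : ℝ) - 4) (-(i : ℝ)) := fun i τ hτ => ⟨by linarith [hτ.1], hτ.2⟩
  have hG : ∀ τ < 0, τ ∈ Ioo (-(ι τ : ℝ) - 3) (-(ι τ : ℝ)) := fun τ hτ =>
    ⟨by linarith [(hι τ hτ).1], (hι τ hτ).2⟩
  set m := ι t with hm
  have htm := hι t ht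
  have htG : t ∈ Ioo (-(m : ℝ) - 3) (-(m : ℝ)) := hG t ht
  have hsG : s ∈ Ioo (-(m : ℝ) - 3) (-(m : ℝ)) := ⟨hs, by linarith [htm.2]⟩
  have hIcc : Icc s t ⊆ Ioo (-(m : ℝ) - 3) (-(m : ℝ)) := fun τ hτ =>
    ⟨by linarith [hτ.1], by linarith [hτ.2, htm.2]⟩
  have hsmG : ∀ τ ∈ Ioo (-(m : ℝ) - 3) (-(m : ℝ)), ContDiff ℝ ∞ (Uw m τ) := fun τ hτ =>
    hsm m τ (hWG m τ hτ)
  -- a.e. agreement of the window and glued integrands on `Ι s t`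
  have hagree : ∀ᵐ τ ∂(volume : Measure ℝ), τ ∈ Set.uIoc s t →
      Δ (curl (Uw m τ)) x - fderiv ℝ (curl (Uw m τ)) x (Uw m τ x + bw m τ) +
          fderiv ℝ (Uw m τ) x (curl (Uw m τ) x) =
        Δ (curl (Uw (ι τ) τ)) x - fderiv ℝ (curl (Uw (ι τ) τ)) x (Uw (ι τ) τ x + bw (ι τ) τ) +
          fderiv ℝ (Uw (ι τ) τ) x (curl (Uw (ι τ) τ) x) := by
    filter_upwards [ae_overlap_apply_eq hae hsm] with τ hτ hτI
    rw [uIoc_of_le hst] at hτI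
    have hτG : τ ∈ Ioo (-(m : ℝ) - 3) (-(m : ℝ)) := hIcc ⟨hτI.1.le, hτI.2⟩
    have hτ0 : τ < 0 := lt_of_le_of_lt hτI.2 ht
    have hτG' := hG τ hτ0
    have hF : fderiv ℝ (Uw (ι τ) τ) = fderiv ℝ (Uw m τ) := overlap_fderiv_eq hae hsm hlip hτG' hτG
    have hcurl : curl (Uw (ι τ) τ) = curl (Uw m τ) := overlap_curl_eq hae hsm hlip hτG' hτG
    have h0 : Uw (ι τ) τ x + bw (ι τ) τ = Uw m τ x + bw m τ :=
      hτ (ι τ) m (hWG _ τ hτG') (hWG m τ hτG) x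
    rw [hF, hcurl, h0]
  -- integrability of the window integrand on `[s, t]`
  have hA : ContinuousOn (fun τ => Δ (curl (Uw m τ)) x) (Ioo (-(m : ℝ) - 3) (-(m : ℝ))) :=
    continuousOn_laplacian_curl_family hsmG (hlip m) x
  have hB : ContinuousOn (fun τ => fderiv ℝ (curl (Uw m τ)) x) (Ioo (-(m : ℝ) - 3) (-(m : ℝ))) :=
    continuousOn_fderiv_curl_family hsmG (hlip m) x
  have hD : ContinuousOn (fun τ => fderiv ℝ (Uw m τ) x) (Ioo (-(m : ℝ) - 3) (-(m : ℝ))) :=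
    continuousOn_fderiv_family (hlip m) x
  have hw : ContinuousOn (fun τ => curl (Uw m τ) x) (Ioo (-(m : ℝ) - 3) (-(m : ℝ))) :=
    continuousOn_curl_family (hlip m) x
  have hV0 : ContinuousOn (fun τ => Uw m τ x) (Ioo (-(m : ℝ) - 3) (-(m : ℝ))) :=
    continuousOn_apply_family (hlip m) x
  have h1 : IntervalIntegrable (fun τ => Δ (curl (Uw m τ)) x) volume s t :=
    (hA.mono hIcc).intervalIntegrable_of_Icc hst
  have h2 : IntervalIntegrable (fun τ => fderiv ℝ (curl (Uw m τ)) x (Uw m τ x)) volume s t :=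
    ((hB.clm_apply hV0).mono hIcc).intervalIntegrable_of_Icc hst
  have h4 : IntervalIntegrable (fun τ => fderiv ℝ (Uw m τ) x (curl (Uw m τ) x)) volume s t :=
    ((hD.clm_apply hw).mono hIcc).intervalIntegrable_of_Icc hst
  have h3 : IntervalIntegrable (fun τ => fderiv ℝ (curl (Uw m τ)) x (bw m τ)) volume s t := by
    rw [intervalIntegrable_iff_integrableOn_Icc_of_le hst]
    have hmeas : AEStronglyMeasurable (fun τ => fderiv ℝ (curl (Uw m τ)) x (bw m τ))
        ((volume : Measure ℝ).restrict (Icc s t)) :=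
      Continuous.comp_aestronglyMeasurable₂
        (g := fun (φ : EuclideanSpace ℝ (Fin 3) →L[ℝ] EuclideanSpace ℝ (Fin 3))
          (v : EuclideanSpace ℝ (Fin 3)) => φ v)
        isBoundedBilinearMap_apply.continuous
        ((hB.mono hIcc).aestronglyMeasurable measurableSet_Icc)
        (hbm m).aestronglyMeasurable
    have hC2 : 0 ≤ C 2 := (norm_nonneg _).trans (hbd m 2 t htG x)
    have hbound : ∀ τ ∈ Icc s t,
        ‖fderiv ℝ (curl (Uw m τ)) x (bw m τ)‖ ≤ ‖curlCLM‖ * C 2 * N := by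
      intro τ hτ
      have hτG := hIcc hτ
      have h2τ : ContDiff ℝ 2 (Uw m τ) := contDiff_infty.1 (hsmG τ hτG) 2
      calc ‖fderiv ℝ (curl (Uw m τ)) x (bw m τ)‖
          ≤ ‖fderiv ℝ (curl (Uw m τ)) x‖ * ‖bw m τ‖ := ContinuousLinearMap.le_opNorm _ _
        _ ≤ (‖curlCLM‖ * C 2) * N := by
            refine mul_le_mul ?_ (hbN m τ) (norm_nonneg _) (by positivity)
            exact (norm_fderiv_curl_le h2τ x).trans (by gcongr; exact hbd m 2 τ hτG x)
    exact Integrable.mono' (integrable_const (‖curlCLM‖ * C 2 * N)) hmeas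
      ((ae_restrict_iff' measurableSet_Icc).2 (Eventually.of_forall hbound))
  have hgm : IntervalIntegrable (fun τ => Δ (curl (Uw m τ)) x -
      fderiv ℝ (curl (Uw m τ)) x (Uw m τ x + bw m τ) + fderiv ℝ (Uw m τ) x (curl (Uw m τ) x))
      volume s t := by
    have e : (fun τ => Δ (curl (Uw m τ)) x - fderiv ℝ (curl (Uw m τ)) x (Uw m τ x + bw m τ) +
        fderiv ℝ (Uw m τ) x (curl (Uw m τ) x)) = fun τ => Δ (curl (Uw m τ)) x -
          (fderiv ℝ (curl (Uw m τ)) x (Uw m τ x) + fderiv ℝ (curl (Uw m τ)) x (bw m τ)) +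
          fderiv ℝ (Uw m τ) x (curl (Uw m τ) x) := by
      funext τ
      rw [map_add]
    rw [e]
    exact (h1.sub (h2.add h3)).add h4
  refine ⟨hgm.congr_ae ((ae_restrict_iff' measurableSet_uIoc).2 hagree), ?_⟩
  -- the identity
  have hcs : curl (Uw (ι s) s) = curl (Uw m s) :=
    overlap_curl_eq hae hsm hlip (hG s (lt_of_le_of_lt hst ht)) hsG
  rw [hcs, hvort m x s t hs hst htm.2]
  exact intervalIntegral.integral_congr_ae hagree

/-- **The vorticity identity for the glued field** for all `s ≤ t < 0` and all `x`, by chaining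
the local identities across consecutive pieces (induction on the length of `[s, t]`;
`intervalIntegral.integral_add_adjacent_intervals`). [folklore] -/
theorem glue_vorticity
    (hbm : ∀ j, Measurable (bw j)) {N : ℝ} (hbN : ∀ j t, ‖bw j t‖ ≤ N)
    (hae : ∀ j : ℕ, ∀ᵐ t ∂((volume : Measure ℝ).restrict (Ioo (-(j : ℝ) - 4) (-(j : ℝ)))),
      u t =ᵐ[volume] fun x => Uw j t x + bw j t)
    (hsm : ∀ j : ℕ, ∀ t ∈ Ioo (-(j : ℝ) - 4) (-(j : ℝ)), ContDiff ℝ ∞ (Uw j t))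
    {C L : ℕ → ℝ}
    (hbd : ∀ (j k : ℕ), ∀ t ∈ Ioo (-(j : ℝ) - 3) (-(j : ℝ)), ∀ x, ‖iteratedFDeriv ℝ k (Uw j t) x‖ ≤ C k)
    (hlip : ∀ (j k : ℕ), ∀ s ∈ Ioo (-(j : ℝ) - 3) (-(j : ℝ)), ∀ t ∈ Ioo (-(j : ℝ) - 3) (-(j : ℝ)), ∀ x,
      ‖iteratedFDeriv ℝ k (Uw j t) x - iteratedFDeriv ℝ k (Uw j s) x‖ ≤ L k * |t - s|)
    (hvort : ∀ (j : ℕ) (x : EuclideanSpace ℝ (Fin 3)) (s t : ℝ),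
      -(j : ℝ) - 3 < s → s ≤ t → t < -(j : ℝ) →
      curl (Uw j t) x - curl (Uw j s) x =
        ∫ τ in s..t, (Δ (curl (Uw j τ)) x - fderiv ℝ (curl (Uw j τ)) x (Uw j τ x + bw j τ) +
          fderiv ℝ (Uw j τ) x (curl (Uw j τ) x)))
    (hι : ∀ t < 0, -(ι t : ℝ) - 1 ≤ t ∧ t < -(ι t : ℝ)) :
    ∀ x, ∀ s t : ℝ, s ≤ t → t < 0 →
      curl (Uw (ι t) t) x - curl (Uw (ι s) s) x =
        ∫ τ in s..t, (Δ (curl (Uw (ι τ) τ)) x -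
          fderiv ℝ (curl (Uw (ι τ) τ)) x (Uw (ι τ) τ x + bw (ι τ) τ) +
          fderiv ℝ (Uw (ι τ) τ) x (curl (Uw (ι τ) τ) x)) := by
  intro x
  have key : ∀ n : ℕ, ∀ s t : ℝ, s ≤ t → t < 0 → t - s ≤ n + 1 →
      IntervalIntegrable (fun τ => Δ (curl (Uw (ι τ) τ)) x -
          fderiv ℝ (curl (Uw (ι τ) τ)) x (Uw (ι τ) τ x + bw (ι τ) τ) +
          fderiv ℝ (Uw (ι τ) τ) x (curl (Uw (ι τ) τ) x)) volume s t ∧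
        curl (Uw (ι t) t) x - curl (Uw (ι s) s) x =
          ∫ τ in s..t, (Δ (curl (Uw (ι τ) τ)) x -
            fderiv ℝ (curl (Uw (ι τ) τ)) x (Uw (ι τ) τ x + bw (ι τ) τ) +
            fderiv ℝ (Uw (ι τ) τ) x (curl (Uw (ι τ) τ) x)) := by
    intro n
    induction n with
    | zero =>
      intro s t hst ht hlen
      refine glue_vorticity_local hbm hbN hae hsm hbd hlip hvort hι x hst ht ?_
      have := (hι t ht).1
      push_cast at hlen
      linarith
    | succ n ih =>
      intro s t hst ht hlen
      rcases le_or_gt (t - s) 1 with h1 | h1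
      · refine glue_vorticity_local hbm hbN hae hsm hbd hlip hvort hι x hst ht ?_
        linarith [(hι t ht).1]
      · set c := s + 1 with hc
        have hsc : s ≤ c := by linarith
        have hct : c ≤ t := by linarith
        have hc0 : c < 0 := by linarith
        have hA := glue_vorticity_local hbm hbN hae hsm hbd hlip hvort hι x hsc hc0
          (by linarith [(hι c hc0).1])
        have hB := ih c t hct ht (by push_cast at hlen ⊢; linarith)
        refine ⟨hA.1.trans hB.1, ?_⟩
        rw [← intervalIntegral.integral_add_adjacent_intervals hA.1 hB.1, ← hA.2, ← hB.2]
        abel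
  intro s t hst ht
  obtain ⟨n, hn⟩ := exists_nat_ge (t - s)
  exact (key n s t hst ht (by linarith)).2

end GluingVorticity

/-! ### Assembly: the ancient fact from the finite-window fact -/

section Assembly

/-- **The finite-window fact on an arbitrary window `(a, a + T)`** (time translation: apply the
printed `(0, T)` statement to `u(· + a)`, `IsBoundedWeakNSSolutionOn.comp_add_right`, and
translate the representative back; the constants do not change). [cite: KochNadirashviliSereginSverak2009, §4 (4.8)–(4.11) with Lemma 3.1 (arXiv:0709.3599v1 numbering)] -/
theorem KNSS2009_regularity_boundedWeak_window.shift
    (h : KNSS2009_regularity_boundedWeak_window) (M T : ℝ) (hT : 0 < T) :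
    ∃ (C L : ℕ → ℝ → ℝ) (N : ℝ), ∀ (a a' : ℝ), a' = a + T →
      ∀ ⦃u : ℝ → EuclideanSpace ℝ (Fin 3) → EuclideanSpace ℝ (Fin 3)⦄,
        IsBoundedWeakNSSolutionOn (Ioo a a') isOpen_Ioo 1 u →
        (∀ t ∈ Ioo a a', ∀ x, ‖u t x‖ ≤ M) →
        ∃ (U : ℝ → EuclideanSpace ℝ (Fin 3) → EuclideanSpace ℝ (Fin 3))
          (b : ℝ → EuclideanSpace ℝ (Fin 3)),
          Measurable b ∧ (∀ t, ‖b t‖ ≤ N) ∧ Measurable (uncurry U) ∧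
          (∀ᵐ t ∂((volume : Measure ℝ).restrict (Ioo a a')),
            u t =ᵐ[volume] fun x => U t x + b t) ∧
          (∀ t ∈ Ioo a a', ContDiff ℝ ∞ (U t)) ∧
          (∀ t ∈ Ioo a a', VectorCalculus.IsDivFree (U t)) ∧
          (∀ δ : ℝ, 0 < δ → ∀ k : ℕ, ∀ t ∈ Ioo (a + δ) a', ∀ x,
            ‖iteratedFDeriv ℝ k (U t) x‖ ≤ C k δ) ∧
          (∀ δ : ℝ, 0 < δ → ∀ k : ℕ, ∀ s ∈ Ioo (a + δ) a', ∀ t ∈ Ioo (a + δ) a', ∀ x,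
            ‖iteratedFDeriv ℝ k (U t) x - iteratedFDeriv ℝ k (U s) x‖ ≤ L k δ * |t - s|) ∧
          (∀ x, ∀ s t : ℝ, a < s → s ≤ t → t < a' →
            curl (U t) x - curl (U s) x =
              ∫ τ in s..t, ((Δ (curl (U τ))) x - fderiv ℝ (curl (U τ)) x (U τ x + b τ) +
                fderiv ℝ (U τ) x (curl (U τ) x))) := by
  obtain ⟨C, L, N, hw⟩ := h M T hT
  refine ⟨C, L, N, ?_⟩
  rintro a a' rfl u hu hM
  have hu' : IsBoundedWeakNSSolutionOn (Ioo 0 T) isOpen_Ioo 1 (fun t => u (t + a)) :=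
    hu.comp_add_right a isOpen_Ioo fun t => by
      constructor
      · intro ht; exact ⟨by linarith [ht.1], by linarith [ht.2]⟩
      · intro ht; exact ⟨by linarith [ht.1], by linarith [ht.2]⟩
  have hM' : ∀ t ∈ Ioo 0 T, ∀ x, ‖u (t + a) x‖ ≤ M := fun t ht x =>
    hM (t + a) ⟨by linarith [ht.1], by linarith [ht.2]⟩ x
  obtain ⟨U', b', hb'm, hb'N, hU'm, hae', hsm', hdiv', hbd', hlip', hvort'⟩ := hw hu' hM'
  refine ⟨fun t => U' (t - a), fun t => b' (t - a), hb'm.comp (measurable_id.sub_const a),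
    fun t => hb'N _, ?_, ?_, fun t ht => hsm' (t - a) ⟨by linarith [ht.1], by linarith [ht.2]⟩,
    fun t ht => hdiv' (t - a) ⟨by linarith [ht.1], by linarith [ht.2]⟩,
    fun δ hδ k t ht x => hbd' δ hδ k (t - a) ⟨by linarith [ht.1], by linarith [ht.2]⟩ x,
    fun δ hδ k s hs t ht x => ?_, fun x s t hs hst ht => ?_⟩
  · -- joint measurability of the translated representative
    have hg : Measurable fun p : ℝ × EuclideanSpace ℝ (Fin 3) => (p.1 - a, p.2) :=
      (measurable_fst.sub_const a).prodMk measurable_snd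
    exact hU'm.comp hg
  · -- the a.e. identity, transported along `t ↦ t - a`
    rw [ae_restrict_iff' measurableSet_Ioo] at hae' ⊢
    have h2 := (measurePreserving_sub_right (volume : Measure ℝ) a).quasiMeasurePreserving.ae
      hae'
    filter_upwards [h2] with t ht hta
    have := ht ⟨by linarith [hta.1], by linarith [hta.2]⟩
    simp only [sub_add_cancel] at this
    exact this
  · have := hlip' δ hδ k (s - a) ⟨by linarith [hs.1], by linarith [hs.2]⟩ (t - a)
      ⟨by linarith [ht.1], by linarith [ht.2]⟩ x
    rwa [show t - a - (s - a) = t - s by ring] at this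
  · have hv := hvort' x (s - a) (t - a) (by linarith) (by linarith) (by linarith)
    have e := intervalIntegral.integral_comp_sub_right (a := s) (b := t)
      (fun τ => Δ (curl (U' τ)) x - fderiv ℝ (curl (U' τ)) x (U' τ x + b' τ) +
        fderiv ℝ (U' τ) x (curl (U' τ) x)) a
    rw [hv, ← e]

/-- **KNSS 2009, §4 on `ℝ³ × (−∞, 0)` from §4 on `ℝ³ × (0, T)`.** The ancient regularity fact
`KNSS2009_regularity_boundedWeak_ancient` follows from the finite-window fact
`KNSS2009_regularity_boundedWeak_window` (the printed form of §4): apply it, with `T = 4` and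
`δ = 1`, to the restrictions of `u` to the windows `(−j − 4, −j)`, `j ∈ ℕ` (time translation,
`KNSS2009_regularity_boundedWeak_window.shift`; the constants depend only on `M = sup ‖u‖`), and
glue the decompositions `u = U_j + b_j` along the pieces `[−j − 1, −j)`: measurability, the a.e.
identity, smoothness, `div U = 0` and the derivative bounds are piecewise (`measurable_glue`,
`ae_eq_glue`, `glue_pointwise`); the derivatives of order `≥ 1` are intrinsic on overlaps
(`overlap_iteratedFDeriv_succ_eq`), whence the global Lipschitz bound (`glue_lipschitz`); and the
vorticity identity chains across pieces (`glue_vorticity`). This is the argument behind "By the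
results of Section 4, we have `|∇ᵏₓu| ≤ C_k` in `ℝ³ × (−∞, 0)`" (arXiv:0709.3599, proof of
Theorem 5.2, first sentence). [cite: KochNadirashviliSereginSverak2009, §4 (4.8)–(4.11) with Lemma 3.1; §5, proof of Thm 5.2, first sentence (arXiv:0709.3599v1)] -/
theorem KNSS2009_regularity_boundedWeak_ancient_of_window
    (h : KNSS2009_regularity_boundedWeak_window) : KNSS2009_regularity_boundedWeak_ancient := by
  intro u hu
  obtain ⟨M, hM⟩ := hu.isBoundedOn
  obtain ⟨C, L, N, hwin⟩ := KNSS2009_regularity_boundedWeak_window.shift h M 4 (by norm_num)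
  have hneg : ∀ (j : ℕ) (t : ℝ), t ∈ Ioo (-(j : ℝ) - 4) (-(j : ℝ)) → t < 0 := fun j t ht =>
    lt_of_lt_of_le ht.2 (neg_nonpos.2 (Nat.cast_nonneg j))
  have hsol : ∀ j : ℕ, IsBoundedWeakNSSolutionOn (Ioo (-(j : ℝ) - 4) (-(j : ℝ))) isOpen_Ioo 1 u :=
    fun j => hu.mono isOpen_Ioo fun t ht => hneg j t ht
  have hbdd : ∀ j : ℕ, ∀ t ∈ Ioo (-(j : ℝ) - 4) (-(j : ℝ)), ∀ x, ‖u t x‖ ≤ M :=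
    fun j t ht x => hM t (hneg j t ht) x
  choose Uw bw hspec using fun j : ℕ =>
    hwin (-(j : ℝ) - 4) (-(j : ℝ)) (by ring) (hsol j) (hbdd j)
  -- the window data in the shape of the gluing lemmas (`δ = 1`)
  set C1 : ℕ → ℝ := fun k => C k 1 with hC1
  set L1 : ℕ → ℝ := fun k => L k 1 with hL1
  have hbm : ∀ j, Measurable (bw j) := fun j => (hspec j).1
  have hbN : ∀ j t, ‖bw j t‖ ≤ N := fun j => (hspec j).2.1
  have hUm : ∀ j, Measurable (uncurry (Uw j)) := fun j => (hspec j).2.2.1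
  have hae : ∀ j : ℕ, ∀ᵐ t ∂((volume : Measure ℝ).restrict (Ioo (-(j : ℝ) - 4) (-(j : ℝ)))),
      u t =ᵐ[volume] fun x => Uw j t x + bw j t := fun j => (hspec j).2.2.2.1
  have hsm : ∀ j : ℕ, ∀ t ∈ Ioo (-(j : ℝ) - 4) (-(j : ℝ)), ContDiff ℝ ∞ (Uw j t) :=
    fun j => (hspec j).2.2.2.2.1
  have hdf : ∀ j : ℕ, ∀ t ∈ Ioo (-(j : ℝ) - 4) (-(j : ℝ)), VectorCalculus.IsDivFree (Uw j t) :=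
    fun j => (hspec j).2.2.2.2.2.1
  have hbd : ∀ (j k : ℕ), ∀ t ∈ Ioo (-(j : ℝ) - 3) (-(j : ℝ)), ∀ x,
      ‖iteratedFDeriv ℝ k (Uw j t) x‖ ≤ C1 k := fun j k t ht x =>
    (hspec j).2.2.2.2.2.2.1 1 one_pos k t ⟨by linarith [ht.1], ht.2⟩ x
  have hlip : ∀ (j k : ℕ), ∀ s ∈ Ioo (-(j : ℝ) - 3) (-(j : ℝ)), ∀ t ∈ Ioo (-(j : ℝ) - 3) (-(j : ℝ)),
      ∀ x, ‖iteratedFDeriv ℝ k (Uw j t) x - iteratedFDeriv ℝ k (Uw j s) x‖ ≤ L1 k * |t - s| :=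
    fun j k s hs t ht x => (hspec j).2.2.2.2.2.2.2.1 1 one_pos k s ⟨by linarith [hs.1], hs.2⟩ t
      ⟨by linarith [ht.1], ht.2⟩ x
  have hvort : ∀ (j : ℕ) (x : EuclideanSpace ℝ (Fin 3)) (s t : ℝ),
      -(j : ℝ) - 3 < s → s ≤ t → t < -(j : ℝ) →
      curl (Uw j t) x - curl (Uw j s) x =
        ∫ τ in s..t, (Δ (curl (Uw j τ)) x - fderiv ℝ (curl (Uw j τ)) x (Uw j τ x + bw j τ) +
          fderiv ℝ (Uw j τ) x (curl (Uw j τ) x)) :=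
    fun j x s t hs hst ht => (hspec j).2.2.2.2.2.2.2.2 x s t (by linarith) hst ht
  -- the selection of pieces `t ∈ [−ι t − 1, −ι t)`
  set ι : ℝ → ℕ := fun t => ⌈-t⌉₊ - 1 with hιdef
  have hι : ∀ t < 0, -(ι t : ℝ) - 1 ≤ t ∧ t < -(ι t : ℝ) := by
    intro t ht
    have hpos : 0 < -t := by linarith
    have h1 : 1 ≤ ⌈-t⌉₊ := Nat.ceil_pos.2 hpos
    have hcast : (ι t : ℝ) = (⌈-t⌉₊ : ℝ) - 1 := by
      simp only [hιdef]
      rw [Nat.cast_sub h1, Nat.cast_one]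
    rw [hcast]
    have h2 : (-t) ≤ ⌈-t⌉₊ := Nat.le_ceil _
    have h3 : (⌈-t⌉₊ : ℝ) < -t + 1 := Nat.ceil_lt_add_one hpos.le
    constructor <;> linarith
  have hιm : Measurable ι :=
    (measurable_from_nat (f := fun n : ℕ => n - 1)).comp (Nat.measurable_ceil.comp measurable_neg)
  have hpt := glue_pointwise (ι := ι) hsm hdf hbd hι
  refine ⟨fun t x => Uw (ι t) t x, fun t => bw (ι t) t, measurable_glue hbm hιm,
    ⟨N, fun t => hbN _ _⟩, measurable_uncurry_glue hUm hιm, ae_eq_glue hae hι, hpt.1, hpt.2.1,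
    fun k => ⟨C1 k, hpt.2.2 k⟩,
    fun k hk => ⟨max (L1 k) (2 * C1 k), glue_lipschitz hae hsm hbd hlip hι hk⟩,
    glue_vorticity hbm hbN hae hsm hbd hlip hvort hι⟩

end Assembly

end Literature.Analysis.FluidPDE

end
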